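import Mathlib
import HarnessLib
import Summits.NavierStokesRegularity.NavierStokesRegularity.Theses.StretchingWellBinding
import Summits.NavierStokesRegularity.NavierStokesRegularity.Theses.HalfHolderEnergy
import Summits.NavierStokesRegularity.NavierStokesRegularity.Theses.TypeILiouville
import Summits.NavierStokesRegularity.NavierStokesRegularity.Theses.TypeIQuarterGate
import Summits.NavierStokesRegularity.NavierStokesRegularity.Theorems.StretchingWellBindingEnstrophyQuarterLawSparsenessCoarse
import Summits.NavierStokesRegularity.NavierStokesRegularity.Theorems.StretchingWellBindingEnstrophyQuarterLawFarFieldEnstrophy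
import Summits.NavierStokesRegularity.NavierStokesRegularity.Theorems.StretchingWellBindingEnstrophyQuarterLawToEnergyHalfHolder
import Summits.NavierStokesRegularity.NavierStokesRegularity.Theorems.StretchingWellBindingEnstrophyQuarterLawLocalTypeI
import Summits.NavierStokesRegularity.NavierStokesRegularity.Theorems.StretchingWellBindingEnstrophyQuarterLawSparseSieveAssembly
import Summits.NavierStokesRegularity.NavierStokesRegularity.Theorems.LerayQuarterDissipationRecordTimeTypeI

/-!
# Shelf 1574, line `sparse_sieve`: the line CASHED AS A CHARACTERISATION —
# `EnergyHalfHolder ⟺ (∀ S1) ∧ (∀ S2)` and, on the Type-I shelf, `EnstrophyQuarterLaw ⟺ (∀ S1) ∧ (∀ S2)`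

Helper file (`--supports stmt-NavierStokesRegularity-1574 --as helper`). With both no-loss certificates in
the tree — S1 `UniformLocalTypeI` (`…LocalTypeI.uniformLocalTypeI_of_window`, p619704) and S2
`UniformSparseness` (`…SparsenessCoarse.uniformSparseness_of_window`, this hand) — and the forward assembly
`…SparseSieve.energyHalfHolder_of_uniformLocalTypeI_of_uniformSparseness` (p615745), the two OPEN
velocity-side stubs of `Cruxes/EnstrophyQuarterLaw/Lines/sparse_sieve.lean` (predicates unfolded verbatim,
quantified over all first blow-ups exactly as in the registered stub signatures) are EQUIVALENT, jointly, to
the window quarter law: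

* `uniformSparseness_of_energyHalfHolder` — `EnergyHalfHolder` (stmt-25161) ⇒ (∀ S2);
* `uniformSparseness_of_enstrophyQuarterLaw` — `EnstrophyQuarterLaw` (stmt-1574) ⇒ (∀ S2): the registered
  stub `stub_uniformSparseness` BY NAME (signature verbatim, predicate unfolded) — the complete no-loss
  certificate for S2, superseding the partial `SparsenessByName` forms of the g0 hand;
* `energyHalfHolder_iff_uniformLocalTypeI_and_uniformSparseness` — **UNCONDITIONAL CHARACTERISATION of the
  crux `EnergyHalfHolder` (route `HalfHolderEnergy`, stmt-NavierStokesRegularity-25161)**: ½-Hölder kinetic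
  energy at every first blow-up ⟺ uniform local Type I (CKN `A`, `E`) ∧ uniform sparseness of
  `L³`-concentration at every first blow-up;
* `uniformLocalTypeI_and_uniformSparseness_of_enstrophyQuarterLaw` — `EnstrophyQuarterLaw` (1574) ⇒
  (∀ S1) ∧ (∀ S2) (unconditional);
* `enstrophyQuarterLaw_iff_uniformLocalTypeI_and_uniformSparseness_of_noTypeII` — given the sibling crux
  `TypeIliouvilleNoTypeII` (stmt-0056, sup-rate Type I), `EnstrophyQuarterLaw ⟺ (∀ S1) ∧ (∀ S2)`:
  on the Type-I shelf the quarter law IS "CKN-local Type I plus no satellite swarms".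

HONEST FRAMING: equivalences and implications between OPEN statements; `EnstrophyQuarterLaw` (1574),
`EnergyHalfHolder` (25161), `TypeIliouvilleNoTypeII` (0056), S1 and S2 all stay OPEN; nothing here bears on
the regularity problem. No summit statement is proved.
-/

noncomputable section

-- the summit-side namespace repeats a component by design (D-0017)
set_option linter.dupNamespace false

namespace Summit.NavierStokesRegularity.NavierStokesRegularity.Theorems.EnstrophyQuarterLaw.SparseSieveCharacterisation

open Set MeasureTheory Function Metric Filter Topology
open scoped ENNReal NNReal
open Literature.Analysis.FluidPDE

/-- **`EnergyHalfHolder ⇒ stub_uniformSparseness`**: the window quarter law (crux of route `HalfHolderEnergy`,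
stmt-NavierStokesRegularity-25161) implies the registered stub S2 for every first blow-up (window constant made
non-negative, far field from the landed `SparseSieve.stub_farFieldEnstrophy`, then
`SparsenessCoarse.uniformSparseness_of_window`). Conditional edge between OPEN statements. [folklore] -/
theorem uniformSparseness_of_energyHalfHolder
    (hH : Summit.NavierStokesRegularity.NavierStokesRegularity.Theses.HalfHolderEnergy.EnergyHalfHolder) :
    ∀ (ν T : ℝ), 0 < ν → 0 < T →
    ∀ (u : ℝ → EuclideanSpace ℝ (Fin 3) → EuclideanSpace ℝ (Fin 3))
      (p : ℝ → EuclideanSpace ℝ (Fin 3) → ℝ),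
    IsMaximalSmoothSolution ν 0 u p T → IsLerayHopfOn T ν 0 (u 0) u →
    HasRapidSpatialDecay (u 0) →
    ∃ r₀ : ℝ, 0 < r₀ ∧ ∀ ε₀ : ℝ, 0 < ε₀ → ∃ N₀ : ℕ,
      ∀ t ∈ Set.Ico 0 T, ∀ r ∈ Set.Ioc 0 r₀, ∀ F : Finset (EuclideanSpace ℝ (Fin 3)),
        (∀ x ∈ F, ∀ y ∈ F, x ≠ y → 4 * r ≤ dist x y) →
        (∀ x ∈ F, ENNReal.ofReal (ε₀ ^ 3) ≤ ∫⁻ y in Metric.ball x (2 * r), ‖u t y‖ₑ ^ 3) →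
        F.card ≤ N₀ := by
  intro ν T hν hT u p hmax hLH hdec
  obtain ⟨K, hK⟩ := hH ν T hν hT u p hmax hLH hdec
  have hK' : ∀ a b : ℝ, 0 ≤ a → a ≤ b → b ≤ T →
      ∫⁻ t in Ioo a b, ∫⁻ x, ‖curl (u t) x‖ₑ ^ 2 ≤ ENNReal.ofReal (max K 0 * Real.sqrt (b - a)) :=
    fun a b ha hab hb => (hK a b ha hab hb).trans (ENNReal.ofReal_le_ofReal
      (mul_le_mul_of_nonneg_right (le_max_left _ _) (Real.sqrt_nonneg _)))
  obtain ⟨ρ, B, hB, hFF⟩ := SparseSieve.stub_farFieldEnstrophy ν T hν hT u p hmax hLH hdec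
  exact SparsenessCoarse.uniformSparseness_of_window hν hT hmax.1 hLH hdec (le_max_right K 0) hK' hB hFF

/-- **`EnstrophyQuarterLaw ⇒ stub_uniformSparseness` (the complete no-loss certificate for S2).** The crux
`EnstrophyQuarterLaw` (stmt-NavierStokesRegularity-1574) implies, for every first blow-up `(u, p)` at `T` of a
classical solution that is Leray–Hopf from a rapidly decaying datum, the conclusion of the registered stub
`stub_uniformSparseness` of `Cruxes/EnstrophyQuarterLaw/Lines/sparse_sieve.lean` (signature verbatim, the
Cruxes-local predicate `UniformSparseness T u` unfolded): EQL ⇒ window law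
(`energyHalfHolder_of_enstrophyQuarterLaw`), then `uniformSparseness_of_energyHalfHolder`. This supersedes the
partial forms `SparsenessByName.sparse_early/fine_of_enstrophyQuarterLaw` (all times, all scales `≤ r₀` now).
Conditional edge between OPEN statements; no summit statement is proved. [folklore] -/
theorem uniformSparseness_of_enstrophyQuarterLaw
    (hQ : Summit.NavierStokesRegularity.NavierStokesRegularity.Theses.StretchingWellBinding.EnstrophyQuarterLaw) :
    ∀ (ν T : ℝ), 0 < ν → 0 < T →
    ∀ (u : ℝ → EuclideanSpace ℝ (Fin 3) → EuclideanSpace ℝ (Fin 3))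
      (p : ℝ → EuclideanSpace ℝ (Fin 3) → ℝ),
    IsMaximalSmoothSolution ν 0 u p T → IsLerayHopfOn T ν 0 (u 0) u →
    HasRapidSpatialDecay (u 0) →
    ∃ r₀ : ℝ, 0 < r₀ ∧ ∀ ε₀ : ℝ, 0 < ε₀ → ∃ N₀ : ℕ,
      ∀ t ∈ Set.Ico 0 T, ∀ r ∈ Set.Ioc 0 r₀, ∀ F : Finset (EuclideanSpace ℝ (Fin 3)),
        (∀ x ∈ F, ∀ y ∈ F, x ≠ y → 4 * r ≤ dist x y) →
        (∀ x ∈ F, ENNReal.ofReal (ε₀ ^ 3) ≤ ∫⁻ y in Metric.ball x (2 * r), ‖u t y‖ₑ ^ 3) →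
        F.card ≤ N₀ :=
  uniformSparseness_of_energyHalfHolder
    (Summit.NavierStokesRegularity.NavierStokesRegularity.Theorems.energyHalfHolder_of_enstrophyQuarterLaw hQ)

/-- **CHARACTERISATION of `EnergyHalfHolder` (stmt-NavierStokesRegularity-25161) by the two velocity-side
stubs of line `sparse_sieve`**: the window quarter law holds at every first blow-up **iff** every first
blow-up has uniform local Type I in the CKN quantities (S1) **and** uniformly sparse `L³`-concentration (S2).
(`⇒`: the no-loss certificates `LocalTypeI.uniformLocalTypeI_of_energyHalfHolder` and
`uniformSparseness_of_energyHalfHolder`; `⇐`: the sieve assembly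
`SparseSieve.energyHalfHolder_of_uniformLocalTypeI_of_uniformSparseness`.) Unconditional equivalence of OPEN
statements; neither side is asserted. [folklore] -/
theorem energyHalfHolder_iff_uniformLocalTypeI_and_uniformSparseness :
    Summit.NavierStokesRegularity.NavierStokesRegularity.Theses.HalfHolderEnergy.EnergyHalfHolder ↔
    ((∀ (ν T : ℝ), 0 < ν → 0 < T →
      ∀ (u : ℝ → EuclideanSpace ℝ (Fin 3) → EuclideanSpace ℝ (Fin 3))
        (p : ℝ → EuclideanSpace ℝ (Fin 3) → ℝ),
      IsMaximalSmoothSolution ν 0 u p T → IsLerayHopfOn T ν 0 (u 0) u →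
      HasRapidSpatialDecay (u 0) →
      ∃ M r₀ : ℝ, 0 < M ∧ 0 < r₀ ∧
        (∀ s ∈ Set.Ico 0 T, ∀ (x : EuclideanSpace ℝ (Fin 3)), ∀ R ∈ Set.Ioc 0 r₀,
          ∫⁻ y in Metric.ball x R, ‖u s y‖ₑ ^ 2 ≤ ENNReal.ofReal (M * R)) ∧
        (∀ b ∈ Set.Ioc 0 T, ∀ (x : EuclideanSpace ℝ (Fin 3)), ∀ R ∈ Set.Ioc 0 r₀, R ^ 2 ≤ b →
          ∫⁻ t in Set.Ioo (b - R ^ 2) b, ∫⁻ y in Metric.ball x R, ‖fderiv ℝ (u t) y‖ₑ ^ 2 ≤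
            ENNReal.ofReal (M * R))) ∧
    (∀ (ν T : ℝ), 0 < ν → 0 < T →
      ∀ (u : ℝ → EuclideanSpace ℝ (Fin 3) → EuclideanSpace ℝ (Fin 3))
        (p : ℝ → EuclideanSpace ℝ (Fin 3) → ℝ),
      IsMaximalSmoothSolution ν 0 u p T → IsLerayHopfOn T ν 0 (u 0) u →
      HasRapidSpatialDecay (u 0) →
      ∃ r₀ : ℝ, 0 < r₀ ∧ ∀ ε₀ : ℝ, 0 < ε₀ → ∃ N₀ : ℕ,
        ∀ t ∈ Set.Ico 0 T, ∀ r ∈ Set.Ioc 0 r₀, ∀ F : Finset (EuclideanSpace ℝ (Fin 3)),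
          (∀ x ∈ F, ∀ y ∈ F, x ≠ y → 4 * r ≤ dist x y) →
          (∀ x ∈ F, ENNReal.ofReal (ε₀ ^ 3) ≤ ∫⁻ y in Metric.ball x (2 * r), ‖u t y‖ₑ ^ 3) →
          F.card ≤ N₀)) :=
  ⟨fun hH => ⟨LocalTypeI.uniformLocalTypeI_of_energyHalfHolder hH, uniformSparseness_of_energyHalfHolder hH⟩,
    fun h => SparseSieve.energyHalfHolder_of_uniformLocalTypeI_of_uniformSparseness h.1 h.2⟩

/-- **`EnstrophyQuarterLaw ⇒ (∀ S1) ∧ (∀ S2)`** — both OPEN velocity-side stubs of the 1574 skeleton of record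
are consequences of the crux they serve (through `energyHalfHolder_of_enstrophyQuarterLaw`, EQL ⇒ HHE, and the
characterisation above): the cut `EnstrophyQuarterLaw ⇐ NoTypeII ∧ S1 ∧ S2` of `Lines/sparse_sieve.lean`
loses nothing on S1, S2. Unconditional implication between OPEN statements. [folklore] -/
theorem uniformLocalTypeI_and_uniformSparseness_of_enstrophyQuarterLaw
    (hQ : Summit.NavierStokesRegularity.NavierStokesRegularity.Theses.StretchingWellBinding.EnstrophyQuarterLaw) :
    (∀ (ν T : ℝ), 0 < ν → 0 < T →
      ∀ (u : ℝ → EuclideanSpace ℝ (Fin 3) → EuclideanSpace ℝ (Fin 3))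
        (p : ℝ → EuclideanSpace ℝ (Fin 3) → ℝ),
      IsMaximalSmoothSolution ν 0 u p T → IsLerayHopfOn T ν 0 (u 0) u →
      HasRapidSpatialDecay (u 0) →
      ∃ M r₀ : ℝ, 0 < M ∧ 0 < r₀ ∧
        (∀ s ∈ Set.Ico 0 T, ∀ (x : EuclideanSpace ℝ (Fin 3)), ∀ R ∈ Set.Ioc 0 r₀,
          ∫⁻ y in Metric.ball x R, ‖u s y‖ₑ ^ 2 ≤ ENNReal.ofReal (M * R)) ∧
        (∀ b ∈ Set.Ioc 0 T, ∀ (x : EuclideanSpace ℝ (Fin 3)), ∀ R ∈ Set.Ioc 0 r₀, R ^ 2 ≤ b →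
          ∫⁻ t in Set.Ioo (b - R ^ 2) b, ∫⁻ y in Metric.ball x R, ‖fderiv ℝ (u t) y‖ₑ ^ 2 ≤
            ENNReal.ofReal (M * R))) ∧
    (∀ (ν T : ℝ), 0 < ν → 0 < T →
      ∀ (u : ℝ → EuclideanSpace ℝ (Fin 3) → EuclideanSpace ℝ (Fin 3))
        (p : ℝ → EuclideanSpace ℝ (Fin 3) → ℝ),
      IsMaximalSmoothSolution ν 0 u p T → IsLerayHopfOn T ν 0 (u 0) u →
      HasRapidSpatialDecay (u 0) →
      ∃ r₀ : ℝ, 0 < r₀ ∧ ∀ ε₀ : ℝ, 0 < ε₀ → ∃ N₀ : ℕ,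
        ∀ t ∈ Set.Ico 0 T, ∀ r ∈ Set.Ioc 0 r₀, ∀ F : Finset (EuclideanSpace ℝ (Fin 3)),
          (∀ x ∈ F, ∀ y ∈ F, x ≠ y → 4 * r ≤ dist x y) →
          (∀ x ∈ F, ENNReal.ofReal (ε₀ ^ 3) ≤ ∫⁻ y in Metric.ball x (2 * r), ‖u t y‖ₑ ^ 3) →
          F.card ≤ N₀) :=
  energyHalfHolder_iff_uniformLocalTypeI_and_uniformSparseness.1
    (Summit.NavierStokesRegularity.NavierStokesRegularity.Theorems.energyHalfHolder_of_enstrophyQuarterLaw hQ)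

/-- **On the Type-I shelf the quarter law IS "CKN-local Type I + no satellite swarms"**: given the sibling
crux `TypeIliouvilleNoTypeII` (stmt-NavierStokesRegularity-0056, sup-rate Type I at every first blow-up),
`EnstrophyQuarterLaw` (1574) ⟺ (∀ S1) ∧ (∀ S2). (`⇒` unconditionally, above; `⇐` is the skeleton theorem of
`Lines/sparse_sieve.lean` with its open stubs as hypotheses,
`SparseSieve.enstrophyQuarterLaw_of_noTypeII_of_uniformLocalTypeI_of_uniformSparseness`.) All statements
involved are OPEN; nothing unconditional about 1574 or 0056 is claimed. [folklore] -/
theorem enstrophyQuarterLaw_iff_uniformLocalTypeI_and_uniformSparseness_of_noTypeII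
    (hN : Summit.NavierStokesRegularity.NavierStokesRegularity.Theses.TypeILiouville.TypeIliouvilleNoTypeII) :
    Summit.NavierStokesRegularity.NavierStokesRegularity.Theses.StretchingWellBinding.EnstrophyQuarterLaw ↔
    ((∀ (ν T : ℝ), 0 < ν → 0 < T →
      ∀ (u : ℝ → EuclideanSpace ℝ (Fin 3) → EuclideanSpace ℝ (Fin 3))
        (p : ℝ → EuclideanSpace ℝ (Fin 3) → ℝ),
      IsMaximalSmoothSolution ν 0 u p T → IsLerayHopfOn T ν 0 (u 0) u →
      HasRapidSpatialDecay (u 0) →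
      ∃ M r₀ : ℝ, 0 < M ∧ 0 < r₀ ∧
        (∀ s ∈ Set.Ico 0 T, ∀ (x : EuclideanSpace ℝ (Fin 3)), ∀ R ∈ Set.Ioc 0 r₀,
          ∫⁻ y in Metric.ball x R, ‖u s y‖ₑ ^ 2 ≤ ENNReal.ofReal (M * R)) ∧
        (∀ b ∈ Set.Ioc 0 T, ∀ (x : EuclideanSpace ℝ (Fin 3)), ∀ R ∈ Set.Ioc 0 r₀, R ^ 2 ≤ b →
          ∫⁻ t in Set.Ioo (b - R ^ 2) b, ∫⁻ y in Metric.ball x R, ‖fderiv ℝ (u t) y‖ₑ ^ 2 ≤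
            ENNReal.ofReal (M * R))) ∧
    (∀ (ν T : ℝ), 0 < ν → 0 < T →
      ∀ (u : ℝ → EuclideanSpace ℝ (Fin 3) → EuclideanSpace ℝ (Fin 3))
        (p : ℝ → EuclideanSpace ℝ (Fin 3) → ℝ),
      IsMaximalSmoothSolution ν 0 u p T → IsLerayHopfOn T ν 0 (u 0) u →
      HasRapidSpatialDecay (u 0) →
      ∃ r₀ : ℝ, 0 < r₀ ∧ ∀ ε₀ : ℝ, 0 < ε₀ → ∃ N₀ : ℕ,
        ∀ t ∈ Set.Ico 0 T, ∀ r ∈ Set.Ioc 0 r₀, ∀ F : Finset (EuclideanSpace ℝ (Fin 3)),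
          (∀ x ∈ F, ∀ y ∈ F, x ≠ y → 4 * r ≤ dist x y) →
          (∀ x ∈ F, ENNReal.ofReal (ε₀ ^ 3) ≤ ∫⁻ y in Metric.ball x (2 * r), ‖u t y‖ₑ ^ 3) →
          F.card ≤ N₀)) :=
  ⟨uniformLocalTypeI_and_uniformSparseness_of_enstrophyQuarterLaw,
    fun h => SparseSieve.enstrophyQuarterLaw_of_noTypeII_of_uniformLocalTypeI_of_uniformSparseness hN h.1 h.2⟩

/-! ### APPENDED (same hand): the line is an EXACT decomposition — `EQL ⟺ 0056 ∧ (∀ S1) ∧ (∀ S2)` -/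

/-- **THE SKELETON OF LINE `sparse_sieve` IS AN EQUIVALENCE.** Unconditionally,
`EnstrophyQuarterLaw` (stmt-NavierStokesRegularity-1574) ⟺ `TypeIliouvilleNoTypeII` (stmt-0056, stub 6)
∧ (∀ first blow-ups, `UniformLocalTypeI`) (stub S1) ∧ (∀ first blow-ups, `UniformSparseness`) (stub S2) — the three
OPEN stubs of `Cruxes/EnstrophyQuarterLaw/Lines/sparse_sieve.lean`, predicates unfolded verbatim. `→`: stub 6
by the landed record-time capacity lemma `RecordTimeTypeI.main` of route `LerayQuarterDissipation` (the slice
quarter law forces the velocity Type-I rate; inlined here so that no theorem of this file has an open item as its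
head) and `uniformLocalTypeI_and_uniformSparseness_of_enstrophyQuarterLaw` for S1, S2;
`←`: the skeleton theorem with its open stubs as hypotheses
(`SparseSieve.enstrophyQuarterLaw_of_noTypeII_of_uniformLocalTypeI_of_uniformSparseness`). Hence the line's cut is
EXACT: proving the three stubs is neither more nor less than proving the crux. Every statement involved is OPEN;
nothing here bears on the regularity problem; no summit statement is proved. [folklore] -/
theorem enstrophyQuarterLaw_iff_noTypeII_and_uniformLocalTypeI_and_uniformSparseness :
    Summit.NavierStokesRegularity.NavierStokesRegularity.Theses.StretchingWellBinding.EnstrophyQuarterLaw ↔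
    (Summit.NavierStokesRegularity.NavierStokesRegularity.Theses.TypeILiouville.TypeIliouvilleNoTypeII ∧
    (∀ (ν T : ℝ), 0 < ν → 0 < T →
      ∀ (u : ℝ → EuclideanSpace ℝ (Fin 3) → EuclideanSpace ℝ (Fin 3))
        (p : ℝ → EuclideanSpace ℝ (Fin 3) → ℝ),
      IsMaximalSmoothSolution ν 0 u p T → IsLerayHopfOn T ν 0 (u 0) u →
      HasRapidSpatialDecay (u 0) →
      ∃ M r₀ : ℝ, 0 < M ∧ 0 < r₀ ∧
        (∀ s ∈ Set.Ico 0 T, ∀ (x : EuclideanSpace ℝ (Fin 3)), ∀ R ∈ Set.Ioc 0 r₀,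
          ∫⁻ y in Metric.ball x R, ‖u s y‖ₑ ^ 2 ≤ ENNReal.ofReal (M * R)) ∧
        (∀ b ∈ Set.Ioc 0 T, ∀ (x : EuclideanSpace ℝ (Fin 3)), ∀ R ∈ Set.Ioc 0 r₀, R ^ 2 ≤ b →
          ∫⁻ t in Set.Ioo (b - R ^ 2) b, ∫⁻ y in Metric.ball x R, ‖fderiv ℝ (u t) y‖ₑ ^ 2 ≤
            ENNReal.ofReal (M * R))) ∧
    (∀ (ν T : ℝ), 0 < ν → 0 < T →
      ∀ (u : ℝ → EuclideanSpace ℝ (Fin 3) → EuclideanSpace ℝ (Fin 3))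
        (p : ℝ → EuclideanSpace ℝ (Fin 3) → ℝ),
      IsMaximalSmoothSolution ν 0 u p T → IsLerayHopfOn T ν 0 (u 0) u →
      HasRapidSpatialDecay (u 0) →
      ∃ r₀ : ℝ, 0 < r₀ ∧ ∀ ε₀ : ℝ, 0 < ε₀ → ∃ N₀ : ℕ,
        ∀ t ∈ Set.Ico 0 T, ∀ r ∈ Set.Ioc 0 r₀, ∀ F : Finset (EuclideanSpace ℝ (Fin 3)),
          (∀ x ∈ F, ∀ y ∈ F, x ≠ y → 4 * r ≤ dist x y) →
          (∀ x ∈ F, ENNReal.ofReal (ε₀ ^ 3) ≤ ∫⁻ y in Metric.ball x (2 * r), ‖u t y‖ₑ ^ 3) →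
          F.card ≤ N₀)) :=
  ⟨fun hQ => ⟨fun ν T hν hT u p hmax hLH hdec => by
      obtain ⟨K, hK⟩ := hQ ν T hν hT u p hmax hLH hdec
      exact RecordTimeTypeI.main hν hT hmax.1 hLH hdec K hK,
      uniformLocalTypeI_and_uniformSparseness_of_enstrophyQuarterLaw hQ⟩,
    fun h => SparseSieve.enstrophyQuarterLaw_of_noTypeII_of_uniformLocalTypeI_of_uniformSparseness h.1 h.2.1 h.2.2⟩

/-! ### APPENDED (same hand): on the Type-I shelf, TIQG's crux `QuarterLawTypeI` (stmt-23726) IS `S1 ∧ S2` -/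

/-- **Given `NoTypeII` (stmt-0056), the quarter law on Type-I blow-ups `QuarterLawTypeI` (route `TypeIQuarterGate`,
stmt-NavierStokesRegularity-23726) ⟺ (∀ first blow-ups, `UniformLocalTypeI`) ∧ (∀ first blow-ups,
`UniformSparseness`)** — the attacked crux of TIQG in the CKN currency of line `sparse_sieve`. Pure logic on top of
`enstrophyQuarterLaw_iff_noTypeII_and_uniformLocalTypeI_and_uniformSparseness`: under 0056 every first blow-up is
Type I, so K1 is the slice quarter law (1574), whose exact decomposition is `0056 ∧ S1 ∧ S2`. All statements are
OPEN; nothing unconditional about 23726 or 0056 is claimed; no summit statement is proved. [folklore] -/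
theorem quarterLawTypeI_iff_uniformLocalTypeI_and_uniformSparseness_of_noTypeII
    (hN : Summit.NavierStokesRegularity.NavierStokesRegularity.Theses.TypeILiouville.TypeIliouvilleNoTypeII) :
    Summit.NavierStokesRegularity.NavierStokesRegularity.Theses.TypeIQuarterGate.QuarterLawTypeI ↔
    ((∀ (ν T : ℝ), 0 < ν → 0 < T →
      ∀ (u : ℝ → EuclideanSpace ℝ (Fin 3) → EuclideanSpace ℝ (Fin 3))
        (p : ℝ → EuclideanSpace ℝ (Fin 3) → ℝ),
      IsMaximalSmoothSolution ν 0 u p T → IsLerayHopfOn T ν 0 (u 0) u →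
      HasRapidSpatialDecay (u 0) →
      ∃ M r₀ : ℝ, 0 < M ∧ 0 < r₀ ∧
        (∀ s ∈ Set.Ico 0 T, ∀ (x : EuclideanSpace ℝ (Fin 3)), ∀ R ∈ Set.Ioc 0 r₀,
          ∫⁻ y in Metric.ball x R, ‖u s y‖ₑ ^ 2 ≤ ENNReal.ofReal (M * R)) ∧
        (∀ b ∈ Set.Ioc 0 T, ∀ (x : EuclideanSpace ℝ (Fin 3)), ∀ R ∈ Set.Ioc 0 r₀, R ^ 2 ≤ b →
          ∫⁻ t in Set.Ioo (b - R ^ 2) b, ∫⁻ y in Metric.ball x R, ‖fderiv ℝ (u t) y‖ₑ ^ 2 ≤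
            ENNReal.ofReal (M * R))) ∧
    (∀ (ν T : ℝ), 0 < ν → 0 < T →
      ∀ (u : ℝ → EuclideanSpace ℝ (Fin 3) → EuclideanSpace ℝ (Fin 3))
        (p : ℝ → EuclideanSpace ℝ (Fin 3) → ℝ),
      IsMaximalSmoothSolution ν 0 u p T → IsLerayHopfOn T ν 0 (u 0) u →
      HasRapidSpatialDecay (u 0) →
      ∃ r₀ : ℝ, 0 < r₀ ∧ ∀ ε₀ : ℝ, 0 < ε₀ → ∃ N₀ : ℕ,
        ∀ t ∈ Set.Ico 0 T, ∀ r ∈ Set.Ioc 0 r₀, ∀ F : Finset (EuclideanSpace ℝ (Fin 3)),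
          (∀ x ∈ F, ∀ y ∈ F, x ≠ y → 4 * r ≤ dist x y) →
          (∀ x ∈ F, ENNReal.ofReal (ε₀ ^ 3) ≤ ∫⁻ y in Metric.ball x (2 * r), ‖u t y‖ₑ ^ 3) →
          F.card ≤ N₀)) := by
  have hQK : Summit.NavierStokesRegularity.NavierStokesRegularity.Theses.StretchingWellBinding.EnstrophyQuarterLaw ↔
      Summit.NavierStokesRegularity.NavierStokesRegularity.Theses.TypeIQuarterGate.QuarterLawTypeI :=
    ⟨fun hQ ν T hν hT u p hmax hLH hdec _ => hQ ν T hν hT u p hmax hLH hdec,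
      fun hK ν T hν hT u p hmax hLH hdec => hK ν T hν hT u p hmax hLH hdec (hN ν T hν hT u p hmax hLH hdec)⟩
  rw [← hQK]
  exact enstrophyQuarterLaw_iff_uniformLocalTypeI_and_uniformSparseness_of_noTypeII hN

end Summit.NavierStokesRegularity.NavierStokesRegularity.Theorems.EnstrophyQuarterLaw.SparseSieveCharacterisation

end
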